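import Mathlib
import HarnessLib
import Summits.Ventures.LatticeQCDFlow.Exactness.GlobalAutomorphismSymmetry
import Summits.Ventures.LatticeQCDFlow.Exactness.KernelCouplingTranslation

/-!
# Plaquette-kernel coupling layers commute with every GLOBAL AUTOMORPHISM `U ↦ φ ∘ U` their kernel intertwines (charge conjugation of `SU(N)`, complex conjugation of `U(1)`); exact Jacobians are then `φ`-invariant

HONEST FRAMING: exact (Metropolis-corrected) sampling algorithms for lattice gauge theory;
figures of merit are autocorrelation/cost numbers at stated couplings and volumes; no
continuum-physics claim.

Venture `LatticeQCDFlow` (cell pub-lqcd), topic `Exactness`; FANOUT row 10 (`eng-equiv`, engine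
`latflow.equiv` / `latflow.flows_jax`: `u1.py` NCP / spline plaquette couplings, `spectral.py`
`SU(N)` spectral plaquette couplings — the KERNEL COUPLING LAYER `V e ↦ h(V,e)(P_e) · P_e⁻¹ · V e`
of `KernelCouplingGaugeEquivariance` / `KernelCouplingMask` / `KernelCouplingTranslation`).  NEW WORK
of the cell; nothing is cited as a fact; no number; no definition is introduced.  Rows 16 / 21's
`GlobalAutomorphismSymmetry` packages the global action `configAut φ : U ↦ φ ∘ U` of a continuous
automorphism `φ : G ≃ₜ* G` as a measurable automorphism preserving product Haar
(`measurePreserving_configAut_piHaar`, `plaquetteHolonomy_configAut`; charge conjugation of `SU(N)`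
is `configConj N = configAut (suConjAut N)`).  This file is the kernel-coupling-layer companion of
`SUNStoutLayerChargeConjugation` (stout layer, `φ = suConjAut`) and `KernelCouplingCenterSymmetry`
(centre twists), for every group and every automorphism at once.

## What is typed (any group `G`, any `φ : G ≃ₜ* G`, any `d`, `L`, any mask `p`)

* **`kernelLayer_configAut`** — loop field `φ`-COVARIANT on active links (`P(φ∘V, e) = φ(P(V,e))`)
  and kernel `φ`-INTERTWINING on active links (`h(φ∘V, e, φ g) = φ(h(V, e, g))`):
  `F(φ∘V) = φ∘F(V)`; **`plaquetteKernelLayer_configAut`** — for the plaquette loop field the first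
  hypothesis IS `plaquetteHolonomy_configAut`, only the kernel's intertwining remains.  WHAT IT
  MEANS for the engine: a `U(1)` NCP / spline kernel `e^{iθ} ↦ e^{if(θ)}` intertwines complex
  conjugation iff `f` is odd, an `SU(N)` spectral kernel intertwines `P ↦ P̄` iff its eigenvalue
  map is odd under `θ ↦ −θ` — constraints the shipped conditioners do NOT impose, so for those
  layers the hypothesis is a design option, not a property of record (stated, not claimed);
* `ae_autInvariant_jacobian_of_comm` / **`autInvariant_jacobian_of_comm`** — compact `G`, product
  Haar: every exact Jacobian of a measurable automorphism `Ψ` of `G^E` with `Ψ(φ∘V) = φ∘Ψ(V)` is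
  `φ`-invariant a.e., and everywhere if continuous (second-countable `G`);
  `autInvariant_modelDensity_of_comm` — so is the model density `(r/j)∘Ψ⁻¹` for a `φ`-invariant
  prior density.

NOT here: the sampler-level statement (with `FlowSamplerTranslationCovariance` §1:
`conjKernel_flowSampler_eq_self` applies to `Θ = configAut φ` verbatim once the target weight is
`φ`-invariant — `wilsonAction_configAut` needs `Re tr ρ(φ g) = Re tr ρ(g)`); numbers.
-/

noncomputable section

namespace Summit.Ventures.LatticeQCDFlow.Exactness

open MeasureTheory
open Literature.MathematicalPhysics.QuantumFieldTheory
open scoped ENNReal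

variable {d L : ℕ}

/-! ## Kernel coupling layers intertwine global automorphisms -/

section AnyGroup

variable {G : Type*} [Group G] [TopologicalSpace G] [MeasurableSpace G] [BorelSpace G] (φ : G ≃ₜ* G)

/-- **Kernel coupling layers commute with every global automorphism their data intertwines** (any
group; `φ`-covariant loop field and `φ`-intertwining kernel on the active links of the mask). -/
theorem kernelLayer_configAut (p : Edge d L → Prop) [DecidablePred p]
    (P : GaugeConfig d L G → Edge d L → G) (h : GaugeConfig d L G → Edge d L → G → G)
    (F : GaugeConfig d L G → GaugeConfig d L G)
    (hF : ∀ V e, F V e = if p e then h V e (P V e) * (P V e)⁻¹ * V e else V e)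
    (hP : ∀ (V : GaugeConfig d L G) (e : Edge d L), p e → P (configAut φ V) e = φ (P V e))
    (hh : ∀ (V : GaugeConfig d L G) (e : Edge d L) (g : G), p e → h (configAut φ V) e (φ g) = φ (h V e g))
    (V : GaugeConfig d L G) :
    F (configAut φ V) = configAut φ (F V) := by
  funext e
  rw [hF, configAut_apply, configAut_apply, hF]
  by_cases he : p e
  · rw [if_pos he, if_pos he, hP V e he, hh V e (P V e) he, map_mul, map_mul, map_inv]
  · rw [if_neg he, if_neg he]

/-- **The plaquette kernel coupling layer commutes with `U ↦ φ ∘ U`** as soon as its kernel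
intertwines `φ` on active links — the loop field's covariance IS `plaquetteHolonomy_configAut`. -/
theorem plaquetteKernelLayer_configAut (p : Edge d L → Prop) [DecidablePred p] (ν : Edge d L → Fin d)
    (h : GaugeConfig d L G → Edge d L → G → G)
    (hh : ∀ (V : GaugeConfig d L G) (e : Edge d L) (g : G), p e → h (configAut φ V) e (φ g) = φ (h V e g))
    (V : GaugeConfig d L G) :
    (fun e : Edge d L =>
        if p e then
          h (configAut φ V) e (plaquetteHolonomy (configAut φ V) e.1 e.2 (ν e)) *
            (plaquetteHolonomy (configAut φ V) e.1 e.2 (ν e))⁻¹ * configAut φ V e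
        else configAut φ V e) =
      configAut φ (fun e : Edge d L =>
        if p e then h V e (plaquetteHolonomy V e.1 e.2 (ν e)) * (plaquetteHolonomy V e.1 e.2 (ν e))⁻¹ * V e
        else V e) :=
  kernelLayer_configAut φ p (fun W e => plaquetteHolonomy W e.1 e.2 (ν e)) h
    (fun W e => if p e then h W e (plaquetteHolonomy W e.1 e.2 (ν e)) * (plaquetteHolonomy W e.1 e.2 (ν e))⁻¹ * W e
      else W e)
    (fun _ _ => rfl) (fun W e _ => plaquetteHolonomy_configAut φ W e.1 e.2 (ν e)) hh V

end AnyGroup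

/-! ## Exact Jacobians of automorphisms commuting with `configAut φ` are `φ`-invariant -/

section Jacobian

variable [NeZero L] {G : Type*} [Group G] [TopologicalSpace G] [IsTopologicalGroup G] [CompactSpace G]
  [MeasurableSpace G] [BorelSpace G] (φ : G ≃ₜ* G)
  (Ψ : GaugeConfig d L G ≃ᵐ GaugeConfig d L G)
  (hΨ : ∀ V : GaugeConfig d L G, Ψ (configAut φ V) = configAut φ (Ψ V))
include hΨ

/-- **Every exact Jacobian of a measurable automorphism of `G^E` commuting with `U ↦ φ ∘ U` is
`φ`-invariant almost everywhere** (product Haar; `φ` preserves Haar — a continuous automorphism of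
a compact group). -/
theorem ae_autInvariant_jacobian_of_comm {J : GaugeConfig d L G → ℝ≥0∞}
    (h : HasJacobian (Measure.pi fun _ : Edge d L => haarProbability G) Ψ J) :
    ∀ᵐ U ∂(Measure.pi fun _ : Edge d L => haarProbability G), J (configAut φ U) = J U := by
  have hae := h.jac_comp_symm_ae_eq (configAut φ) (measurePreserving_configAut_piHaar (d := d) (L := L) φ) hΨ
  filter_upwards [hae] with U hU
  exact hU

/-- **… and everywhere for a continuous exact Jacobian `j ≥ 0`** (second-countable `G`). -/
theorem autInvariant_jacobian_of_comm [SecondCountableTopology G] {j : GaugeConfig d L G → ℝ}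
    (hj : Continuous j) (hj0 : ∀ U, 0 ≤ j U)
    (h : HasJacobian (Measure.pi fun _ : Edge d L => haarProbability G) Ψ (fun U => ENNReal.ofReal (j U)))
    (U : GaugeConfig d L G) : j (configAut φ U) = j U := by
  haveI : (haarProbability G).IsOpenPosMeasure := by unfold haarProbability; infer_instance
  have hTc : Continuous (configAut (d := d) (L := L) φ) :=
    continuous_pi fun e => φ.continuous.comp (continuous_apply e)
  have h1 := HasJacobian.jac_comp_symm_eq hj h (configAut φ)
    (measurePreserving_configAut_piHaar (d := d) (L := L) φ) hTc hΨ U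
  exact (ENNReal.ofReal_eq_ofReal_iff (hj0 _) (hj0 _)).1 h1

/-- **The model density `(r/j) ∘ Ψ⁻¹` of such a flow is `φ`-invariant** for a `φ`-invariant prior
density `r` and a continuous exact Jacobian `j ≥ 0`. -/
theorem autInvariant_modelDensity_of_comm [SecondCountableTopology G] {j r : GaugeConfig d L G → ℝ}
    (hj : Continuous j) (hj0 : ∀ U, 0 ≤ j U)
    (h : HasJacobian (Measure.pi fun _ : Edge d L => haarProbability G) Ψ (fun U => ENNReal.ofReal (j U)))
    (hr : ∀ V : GaugeConfig d L G, r (configAut φ V) = r V) (U : GaugeConfig d L G) :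
    r (Ψ.symm (configAut φ U)) / j (Ψ.symm (configAut φ U)) = r (Ψ.symm U) / j (Ψ.symm U) := by
  have hsymm : Ψ.symm (configAut φ U) = configAut φ (Ψ.symm U) := by
    apply Ψ.injective
    rw [Ψ.apply_symm_apply, hΨ, Ψ.apply_symm_apply]
  rw [hsymm, hr, autInvariant_jacobian_of_comm φ Ψ hΨ hj hj0 h (Ψ.symm U)]

end Jacobian

end Summit.Ventures.LatticeQCDFlow.Exactness

end
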